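import Literature.AnabelianGeometry.AbsoluteAnabelian.LogShellsOfUnitLog
import Literature.IUT.LogThetaLattice.LogLinkIterates
import Mathlib.NumberTheory.Padics.RingHoms
import HarnessLib

/-!
# [IUTchIII] Rmk 1.1.1 (i) / Rmk 1.2.2 (iii): the SECOND iterate of the log-link has EMPTY domain at `ℚ_p`
# (and at every place where `log_k(𝒪_k^×)` contains no unit)

Proof-only companion (abc-iut cell, wave-5 seat abc-iut-w5-d138; kernel form of the INFO item I-1 of the audit of
p412063 `Cor312Ind3Analytic`; no new definitions). S. Mochizuki, *Inter-universal Teichmüller Theory III*,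
kurims manuscript (May 2020), Rmk 1.1.1 (i) p. 28 ("iterates … are to be understood as being defined only on the
[local] units"), Rmk 1.2.2 (iii) p. 37 ("the portions of the various `𝒪^▷` … on which these iterates are
defined"). abc-iut-L6-t3/L6-d2 typed the domain `D_n` of the `n`-th iterate (`iterDomain`: `D_0 = k`,
`D_{n+1} = {x ∈ 𝒪_k^× | log_k x ∈ D_n}`) and proved the "upper semi-commutativity" `log_k^{[n+1]}(D_{n+1}) ⊆ ℐ*`
for every `n`. THIS FILE records when those containments are VACUOUS for `n ≥ 1`:

* `iterDomain_two_eq_empty_of_norm_log_lt_one` — if `‖log_k u‖ < 1` for every unit `u` (i.e. `log_k(𝒪_k^×) ⊆ 𝔪_k`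
  contains no unit), then `D_2 = ∅`, hence `D_{n+2} = ∅` for all `n` (`iterDomain_add_two_eq_empty_of_norm_log_lt_one`):
  only the FIRST iterate of the log-link has a nonempty domain;
* `norm_unitLog_lt_one_of_pow_mem_closedBall` — criterion for the standard model `ofUnitLog p K`: if some power `u^k`
  is a principal unit of level `p*` with `‖p*‖ < ‖k‖`, then `‖log_p u‖ < 1` (`log(1 + p*𝒪) = p*𝒪`, `log(u^k) = k·log u`);
* `Padic.norm_unitLog_lt_one`, `Padic.iterDomain_ofUnitLog_add_two_eq_empty` — at `K = ℚ_p` (every prime `p`;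
  `k = p − 1` via Fermat for odd `p`, `k = 2` for `p = 2`): `log_p(ℤ_p^×) ⊆ pℤ_p`, so the second and all higher
  iterates of the log-link on `ℚ_p` have EMPTY domain — in the model as in print, the `m' ≥ 2` components of the
  (Ind3) "upper semi-commutativity" are empty sets at such places; the contentful clause is `m' = 1`.
Classical `p`-adic analysis; nothing here bears on [IUTchIII] Cor. 3.12. [claim: Mochizuki2012, status: disputed]
for the quoted Remarks only.
-/

noncomputable section

open Set Metric

namespace Literature.IUT.LogThetaLattice

open Literature.IUT.LogVolume Literature.AnabelianGeometry.AbsoluteAnabelian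

/-! ### Abstract: no unit in `log(𝒪^×)` ⇒ the second iterate has empty domain -/

section Abstract

variable {K : Type*} [NontriviallyNormedField K] (L : PadicLogOnUnits K)

/-- **IUTchIII:Rmk1.1.1(i)** (kurims p.28) If `log_k` maps every unit into the open unit ball (no unit lies in
`log_k(𝒪_k^×)`), then the domain `D_2 = {u ∈ 𝒪_k^× | log_k u ∈ 𝒪_k^×}` of the SECOND iterate of the log-link is
empty. [claim: Mochizuki2012, status: disputed] -/
theorem iterDomain_two_eq_empty_of_norm_log_lt_one (h : ∀ x ∈ sphere (0 : K) 1, ‖L.log x‖ < 1) :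
    iterDomain L 2 = ∅ := by
  ext x
  simp only [mem_iterDomain_succ, iterDomain_zero, mem_univ, and_true, mem_empty_iff_false, iff_false,
    not_and]
  intro hx hlx
  have h1 := h x hx
  rw [mem_sphere_zero_iff_norm] at hlx
  exact absurd hlx (ne_of_lt h1)

/-- **IUTchIII:Rmk1.1.1(i)** (kurims p.28) … hence every iterate beyond the first has empty domain:
`D_{n+2} = ∅`. [claim: Mochizuki2012, status: disputed] -/
theorem iterDomain_add_two_eq_empty_of_norm_log_lt_one (h : ∀ x ∈ sphere (0 : K) 1, ‖L.log x‖ < 1)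
    (n : ℕ) : iterDomain L (n + 2) = ∅ := by
  induction n with
  | zero => exact iterDomain_two_eq_empty_of_norm_log_lt_one L h
  | succ n ih => exact eq_empty_of_subset_empty (ih ▸ iterDomain_succ_subset L (n + 2))

/-- **IUTchIII:Rmk1.2.2(iii)** (kurims p.37) Consequently the images of all iterates beyond the first are EMPTY (the
"upper semi-commutativity" containments for them are vacuous). [claim: Mochizuki2012, status: disputed] -/
theorem iterate_image_eq_empty_of_norm_log_lt_one (h : ∀ x ∈ sphere (0 : K) 1, ‖L.log x‖ < 1) (n : ℕ) :
    (L.log^[n + 2]) '' iterDomain L (n + 2) = ∅ := by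
  rw [iterDomain_add_two_eq_empty_of_norm_log_lt_one L h n, image_empty]

end Abstract

/-! ### The standard model `ofUnitLog p K`: a criterion -/

section Model

variable (p : ℕ) [hp : Fact p.Prime] (K : Type*) [NontriviallyNormedField K] [NormedAlgebra ℚ_[p] K]
  [IsUltrametricDist K] [CompleteSpace K] [ProperSpace K]

/-- Criterion at the standard model ([AbsTopIII] Def 5.4 (iii) `log(1 + p*𝒪_k) = p*𝒪_k`): if a unit `u` has a power
`u^k ∈ 1 + p*𝒪_k` with `‖p*‖ < ‖k‖`, then `‖log_p u‖ < 1` (`k·log_p u = log_p(u^k) ∈ p*𝒪_k`).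
[cite: MochizukiAbsTopIII2015, Def 5.4 (iii) p. 126] -/
theorem norm_unitLog_lt_one_of_pow_mem_closedBall {u : K} (hu : ‖u‖ = 1) {k : ℕ}
    (hk : u ^ k ∈ closedBall (1 : K) ‖(PadicLogOnUnits.ofUnitLog p K).pstar‖)
    (hpk : ‖(PadicLogOnUnits.ofUnitLog p K).pstar‖ < ‖(k : K)‖) : ‖unitLog u‖ < 1 := by
  have himg : unitLog (u ^ k) ∈ closedBall (0 : K) ‖(PadicLogOnUnits.ofUnitLog p K).pstar‖ := by
    rw [← (PadicLogOnUnits.ofUnitLog p K).image_principalUnits]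
    exact ⟨u ^ k, hk, rfl⟩
  rw [unitLog_pow p hu k, mem_closedBall_zero_iff, norm_mul] at himg
  have hkpos : 0 < ‖(k : K)‖ := lt_of_le_of_lt (norm_nonneg _) hpk
  have h1 : ‖unitLog u‖ ≤ ‖(PadicLogOnUnits.ofUnitLog p K).pstar‖ / ‖(k : K)‖ := by
    rw [le_div_iff₀ hkpos, mul_comm]; exact himg
  exact lt_of_le_of_lt h1 ((div_lt_one hkpos).mpr hpk)

end Model

/-! ### `ℚ_p`: `log_p(ℤ_p^×) ⊆ pℤ_p`, so `D_2 = ∅` -/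

namespace Padic

variable (p : ℕ) [hp : Fact p.Prime]

/-- In `ℤ_p`, an element killed by the reduction map `ℤ_p → 𝔽_p` has norm `≤ p⁻¹`. [cite: NeukirchANT1999, Ch. II (5.3)] -/
theorem norm_le_inv_of_toZMod_eq_zero {z : ℤ_[p]} (hz : PadicInt.toZMod z = 0) :
    ‖(z : ℚ_[p])‖ ≤ (p : ℝ)⁻¹ := by
  have hmem : z ∈ RingHom.ker (PadicInt.toZMod : ℤ_[p] →+* ZMod p) := hz
  rw [PadicInt.ker_toZMod, PadicInt.maximalIdeal_eq_span_p] at hmem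
  have := (PadicInt.norm_le_pow_iff_mem_span_pow z 1).mpr (by rwa [pow_one])
  rw [← PadicInt.norm_def]
  simpa using this

/-- A unit of `ℤ_p` has nonzero reduction in `𝔽_p`. [cite: NeukirchANT1999, Ch. II (5.3)] -/
theorem toZMod_ne_zero_of_norm_eq_one {z : ℤ_[p]} (hz : ‖z‖ = 1) : PadicInt.toZMod z ≠ 0 :=
  ((PadicInt.isUnit_iff.mpr hz).map PadicInt.toZMod).ne_zero

/-- In `𝔽_2` every nonzero element is `1` (private helper). [folklore] -/
private theorem zmod2_eq_one_of_ne_zero : ∀ a : ZMod 2, a ≠ 0 → a = 1 := by decide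

/-- In `𝔽_2`, `1 + 1 = 0` (private helper). [folklore] -/
private theorem zmod2_one_add_one : (1 : ZMod 2) + 1 = 0 := by decide

/-- **`log_p(ℤ_p^×) ⊆ pℤ_p`**: for every unit `u` of `ℚ_p`, `‖log_p u‖ < 1` (odd `p`: `u^{p−1} ∈ 1 + pℤ_p` by Fermat and
`‖p − 1‖ = 1`; `p = 2`: `u² − 1 = (u − 1)(u + 1) ∈ 4ℤ_2` and `‖2‖ = 1/2 > ‖4‖`). [cite: NeukirchANT1999, Ch. II (5.5)] -/
theorem norm_unitLog_lt_one {u : ℚ_[p]} (hu : ‖u‖ = 1) : ‖unitLog u‖ < 1 := by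
  let z : ℤ_[p] := ⟨u, le_of_eq hu⟩
  have hzu : (z : ℚ_[p]) = u := rfl
  have hz1 : ‖z‖ = 1 := by rw [PadicInt.norm_def]; exact hu
  have hz0 : PadicInt.toZMod z ≠ 0 := toZMod_ne_zero_of_norm_eq_one p hz1
  have hnp : ‖((p : ℕ) : ℚ_[p])‖ = ((p : ℕ) : ℝ)⁻¹ := Padic.norm_p
  by_cases h2 : p = 2
  · -- p = 2: k = 2
    subst h2
    have hunitval : PadicInt.toZMod z = 1 := zmod2_eq_one_of_ne_zero _ hz0
    have hm1 : ‖u - 1‖ ≤ ((2 : ℕ) : ℝ)⁻¹ := by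
      have h := norm_le_inv_of_toZMod_eq_zero 2 (z := z - 1)
        (by rw [map_sub, hunitval, map_one, sub_self])
      exact h
    have hp1 : ‖u + 1‖ ≤ ((2 : ℕ) : ℝ)⁻¹ := by
      have h := norm_le_inv_of_toZMod_eq_zero 2 (z := z + 1)
        (by rw [map_add, hunitval, map_one, zmod2_one_add_one])
      exact h
    have hfac : u ^ 2 - 1 = (u - 1) * (u + 1) := by ring
    refine norm_unitLog_lt_one_of_pow_mem_closedBall 2 ℚ_[2] hu (k := 2) ?_ ?_
    · rw [PadicLogOnUnits.ofUnitLog_pstar, if_pos rfl, mem_closedBall, dist_eq_norm, Nat.cast_pow, norm_pow,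
        hnp, hfac, norm_mul, sq]
      exact mul_le_mul hm1 hp1 (norm_nonneg _) (by positivity)
    · rw [PadicLogOnUnits.ofUnitLog_pstar, if_pos rfl, Nat.cast_pow, norm_pow, hnp]
      norm_num
  · -- p odd: k = p - 1
    refine norm_unitLog_lt_one_of_pow_mem_closedBall p ℚ_[p] hu (k := p - 1) ?_ ?_
    · rw [PadicLogOnUnits.ofUnitLog_pstar, if_neg h2, pow_one, mem_closedBall, dist_eq_norm, hnp]
      have hfermat : PadicInt.toZMod (z ^ (p - 1) - 1) = 0 := by
        rw [map_sub, map_pow, map_one, ZMod.pow_card_sub_one_eq_one hz0, sub_self]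
      exact norm_le_inv_of_toZMod_eq_zero p hfermat
    · rw [PadicLogOnUnits.ofUnitLog_pstar, if_neg h2, pow_one, hnp, Padic.norm_natCast_p_sub_one]
      exact inv_lt_one_of_one_lt₀ (by exact_mod_cast hp.out.one_lt)

/-- **IUTchIII:Rmk1.1.1(i)** (kurims p.28) at `ℚ_p`, every prime `p`: the second and all higher iterates of the log-link on the
units of `ℚ_p` have EMPTY domain (`D_{n+2} = ∅` for the standard model `ofUnitLog p ℚ_p`).
[claim: Mochizuki2012, status: disputed] -/
theorem iterDomain_ofUnitLog_add_two_eq_empty (n : ℕ) :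
    iterDomain (PadicLogOnUnits.ofUnitLog p ℚ_[p]) (n + 2) = ∅ :=
  iterDomain_add_two_eq_empty_of_norm_log_lt_one _
    (fun x hx => by
      rw [PadicLogOnUnits.ofUnitLog_log]
      exact norm_unitLog_lt_one p (mem_sphere_zero_iff_norm.mp hx)) n

end Padic

end Literature.IUT.LogThetaLattice

end
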